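import Literature.NumberTheory.LFunctions.WeilPositivityCertificateData
import HarnessLib

/-!
# Weil positivity at the archimedean place: kernel check of the parity block `0`

`Literature.NumberTheory.LFunctions.checkBlock0_weilCert`: the even parity block of the certificate `Literature.NumberTheory.LFunctions.weilCert`
(`WeilPositivityCertificateData.lean`) passes the checker of `WeilPositivityCertificate.lean`
(`D C = I`, and `S' − UᵀU` diagonally dominant), evaluated by `decide +kernel`
(several minutes of kernel time; kept in its own file). Yoshida 1992, Thm. 1 (p. 310): the
finite part of the proof ("verified rather easily on a computer").
-/

noncomputable section

namespace Literature.NumberTheory.LFunctions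

/-- **Kernel check of the parity block `0`.** [folklore] -/
theorem checkBlock0_weilCert : weilCert.checkBlock weilCert.nuTab 0 = true := by
  decide +kernel

end Literature.NumberTheory.LFunctions
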